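import Literature.Probability.Percolation.Percolation
import HarnessLib

/-!
# Hutchcroft's two-ghost inequality, ghost-free form (Corollary 1.7), on `ℤ^d`

Topic `Probability/Percolation`; namespace `Literature.Probability.Percolation`. A NAMED FACT
(`def … : Prop`, no proof claimed), vendored by the grounder of route
`Summits/CriticalPhenomena/PercolationContinuityZ3/Theses/PercMinContact` for its crux
`TwoArmWindow` (stmt-CriticalPhenomena-11499, clause (a): a `p`-UNIFORM volume two-arm bound
`Σ_{y ∼ 0} P_u(|C(0)| ≥ n, |C(y)| ≥ n, 0 ↮ y) ≤ C n^{-λ}`; the printed inequality gives `λ = 1/2`)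
and for its glue `TwoArmGlue`; it is also the `n^{-1/2}` input quoted by that route's
`MinContactExponent` and by `Hutchcroft2021` (arXiv:2008.11197, p. 6).

## Source (read on the held text `paper:arxiv-1808.08940`, arXiv page numbers)

T. Hutchcroft, *Locality of the critical probability for transitive graphs of exponential growth*,
Ann. Probab. 48 (2020), no. 3, 1352–1371, arXiv:1808.08940 [Hutchcroft2020Locality], §1.1 "The
two-ghost inequality", p. 6:

* (before Thm 1.6) Bernoulli-`p` bond percolation `ω_p` on a connected locally finite graph
  `G = (V, E)`; the ghost field; "`𝒯_e` … the event that `e` is closed and that the endpoints of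
  `e` are in distinct clusters, each of which touches some green edge, and at least one of which
  is finite."
* **Theorem 1.6.** "Let `G` be a unimodular transitive graph of degree `d`. Then
  `ℙ_{p,h}(𝒯_e) ≤ 33 · d [(1-p) h / p]^{1/2}` for every `e ∈ E`, `p ∈ (0,1]` and `h > 0`."
* "Let `𝒮_{e,n}` be the event that `e` is closed and that the endpoints of `e` are in distinct
  clusters, each of which touches at least `n` edges, and at least one of which is finite."
* **Corollary 1.7.** "Let `G` be a unimodular transitive graph of degree `d`. Then
  `ℙ_p(𝒮_{e,n}) ≤ 66 · d [(1-p)/(p n)]^{1/2}` for every `e ∈ E`, `p ∈ (0,1]` and `n ≥ 1`."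
* **Remark 1.8.** the factor `d` "can be removed entirely on edge-transitive graphs such as `ℤ^d`"
  (NOT used below: we vendor the corollary as printed, with the degree factor).

## The specialisation typed here (item = fact ∘ specialisation)

`G = zdGraph d`, the nearest-neighbour graph of `ℤ^d` (`LatticeModels/LatticeGraph.lean`), which
is a Cayley graph of the (amenable, hence unimodular) group `ℤ^d`, vertex-transitive of degree
`2d` — an instance of the printed hypothesis; the printed degree `d` is therefore `2 * d` below
(`d` = dimension here). `ℙ_p = bondPercolation (zdGraph d) p` (`Percolation.lean`: Mathlib's
`setBernoulli` on the edge set; `p : unitInterval` with `0 < p`, i.e. `p ∈ (0,1]`). An edge `e` is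
a pair `s(x, y)` of adjacent sites; "`e` closed" is `s(x, y) ∉ ω` (`ω : BondConfig = Set (Sym2 _)`
is the set of OPEN edges); "distinct clusters" is `¬ (openGraph ω).Reachable x y`; the cluster
`C(x) = openCluster ω x` "touches" the edges of `G` having an endpoint in it,
`{e ∈ (zdGraph d).edgeSet | ∃ v ∈ e, v ∈ openCluster ω x}`, counted in `ℕ∞` by `Set.encard`
("at least `n`" for `n : ℕ`, `1 ≤ n`); "finite" is `Set.Finite`. The probability is the real
measure `Measure.real` of the event (a measurable cylinder-type event; measurability is not part
of the printed statement and is not asserted here — `Measure.real` is defined on every set, and the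
event is in fact measurable, which users prove when they need it).

How route PercMinContact uses it (for provers of `TwoArmWindow` (a) / `TwoArmGlue`): for
`0 < u < p_c` both clusters are a.s. finite (`theta_eq_zero_of_lt_criticalProb`, PROVED), a
cluster with `≥ n` vertices touches `≥ n` edges of `ℤ^d` (each vertex has `2d ≥ 2` incident edges,
each edge counted at most twice), and `0 ↮ y` for a neighbour `y` forces `s(0, y)` closed; summing
over the `2d` neighbours gives `Σ_{y∼0} P_u(|C(0)| ≥ n, |C(y)| ≥ n, 0 ↮ y) ≤ 2d · 66 · 2d ·
√((1-u)/(u n))`, i.e. `λ = 1/2` with a constant uniform on `u ∈ [u₀, p_c)`; uniformity down to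
`u = 0` needs in addition the elementary small-`p` comparison with a subcritical branching process
(`P_u(|C(0)| ≥ n)` decays geometrically in `n`, uniformly for `u ≤ u₀ < 1/(2d-1)`), not this fact.

## References

* T. Hutchcroft, Ann. Probab. 48 (2020) 1352–1371, arXiv:1808.08940: §1.1, Theorem 1.6,
  Corollary 1.7, Remark 1.8. [Hutchcroft2020Locality]
* M. Aizenman, H. Kesten, C. M. Newman, Comm. Math. Phys. 111 (1987) 505–531 (the two-arm
  summation-exchange ancestor, eq. (1.1) of the source). [AizenmanKestenNewman1987]
* T. Hutchcroft, *Power-law bounds for critical long-range percolation below the upper-critical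
  dimension* / *New critical exponent inequalities …*: arXiv:2008.11197 p. 6 quotes Corollary 1.7
  with the constant 66. [Hutchcroft2021]
-/

noncomputable section

open MeasureTheory

namespace Literature.Probability.Percolation

open Literature.Probability.LatticeModels

/-- **Hutchcroft's two-ghost inequality in ghost-free form** (Ann. Probab. 48 (2020),
arXiv:1808.08940, Corollary 1.7, p. 6): for a unimodular transitive graph of degree `d`,
`ℙ_p(𝒮_{e,n}) ≤ 66 · d · [(1-p)/(pn)]^{1/2}` for every edge `e`, every `p ∈ (0,1]` and every
`n ≥ 1`, where `𝒮_{e,n}` is the event that `e` is closed and the endpoints of `e` lie in distinct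
clusters, each touching at least `n` edges, at least one of them finite. Typed for
`G = zdGraph d` (`ℤ^d`, `d ≥ 1`: a unimodular — amenable Cayley — transitive graph of degree
`2d`, so the printed degree factor reads `2 * d`), `ℙ_p = bondPercolation (zdGraph d) p` with
`0 < p`, an edge `e = s(x, y)` of adjacent sites, "closed" = `s(x,y) ∉ ω`, "distinct clusters" =
not `Reachable` in `openGraph ω`, "touches at least `n` edges" = `n ≤ encard` of the edges of
`zdGraph d` meeting the cluster, "finite" = `Set.Finite`. Grounds
`Summit.CriticalPhenomena.PercolationContinuityZ3.Theses.PercMinContact.TwoArmWindow` (clause (a)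
with `λ = 1/2`, after summing over the `2d` neighbours of `0`) — the item is STRONGER than print
(it wants `λ > 1 - 1/Δ₀` together with a volume window). No proof is claimed here; users take
`(h : Hutchcroft2020_twoGhost_corollary)`. [cite: Hutchcroft2020Locality, Corollary 1.7] -/
def Hutchcroft2020_twoGhost_corollary : Prop :=
  ∀ (d : ℕ), 1 ≤ d → ∀ (p : unitInterval), 0 < (p : ℝ) → ∀ (n : ℕ), 1 ≤ n →
    ∀ (x y : Site d), (zdGraph d).Adj x y →
      (bondPercolation (zdGraph d) p).real
          {ω | s(x, y) ∉ ω ∧ ¬ (openGraph ω).Reachable x y ∧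
              (n : ℕ∞) ≤ {e ∈ (zdGraph d).edgeSet | ∃ v ∈ e, v ∈ openCluster ω x}.encard ∧
              (n : ℕ∞) ≤ {e ∈ (zdGraph d).edgeSet | ∃ v ∈ e, v ∈ openCluster ω y}.encard ∧
              ((openCluster ω x).Finite ∨ (openCluster ω y).Finite)}
        ≤ 66 * (2 * (d : ℝ)) * Real.sqrt ((1 - (p : ℝ)) / ((p : ℝ) * n))

/-- Sanity check of the typing (the right-hand side is the printed expression with degree
`2d`): at `p = 1` the bound is `0`, consistent with `𝒮_{e,n} = ∅` there (every edge of `ℤ^d` is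
a.s. open, so no edge is closed) — we record only the arithmetic fact that the printed right-hand
side vanishes at `p = 1`. [folklore] -/
theorem twoGhost_rhs_eq_zero_at_one (d n : ℕ) :
    66 * (2 * (d : ℝ)) * Real.sqrt ((1 - (1 : ℝ)) / ((1 : ℝ) * n)) = 0 := by
  simp

end Literature.Probability.Percolation

end
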